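import Summits.CriticalPhenomena.PercolationContinuityZ3.Theorems.Transplant.Slab111HubXRoute1
import HarnessLib

/-!
# The HUB ROUTING of the `(111)`-films, IV-X (exact ride windows): routing 2 and the swap pair (`hub_gml`)

builds on p205010 (kernel theorem, internal audit signed; external expert review pending) — NOT used in this file.  Lane `prim-bschramm`, seat
`prim-bschramm-p2` (gen 37; class C1b; memo `HOME/bschramm/P2-LATTICES.md` §135); helper file (`--supports stmt-CriticalPhenomena-4575 --as helper`).
From a `HubDataX` («Slab111HubXData», «Slab111HubXLegs») the SECOND routing of the swap pair: the rerouted path runs along the leg of `E₁`, the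
`F₁`-helix from `e₁` to `c`, the hub `H_A`, the `F₂`-helix to `e₂` and the leg of `E₂`; the attachment vertex is `c` with successor `H_A`; the branch
starts at `y`, runs along the `F₁`-helix to `d`, the hub `H_D`, the `F₃`-helix to `e₃`, the leg of `w'`.  With routing 1 («Slab111HubXRoute1»:
successor `y`, branch head `H_A`) this is a SWAP PAIR: **`HubDataX.hub_gml`**, the hub routing lemma of the gen-36 design for
`HexShadow.ShapedLinkage 3 (Slab111.hexShadow k)`. [cite: DuminilCopinSidoraviciusTassion2016, §2.3 (proof of Fact 2: the three disjoint paths γ_u, γ_v, γ_w in B_R(z))]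
-/

noncomputable section

namespace Summit.CriticalPhenomena.PercolationContinuityZ3.Theorems.Transplant

open Literature.Probability.Percolation Literature.Probability.LatticeModels SimpleGraph
open scoped Classical

namespace Slab111

namespace HubDataX

variable {k : ℕ} {z : Site 2} {c0 : ℤ} {W PR : Set (slab111 k)} {E₁ E₂ w' : slab111 k} (X : HubDataX k z c0 W PR E₁ E₂ w')

/-- The rerouted path of routing 2. [folklore] -/
def SP2 : List (slab111 k) := (X.leg₁ ++ X.S1c.tail) ++ ((X.c :: X.HA :: X.S2 X.LA) ++ X.leg₂.tail).tail

/-- The branch of routing 2. [folklore] -/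
def Br2 : List (slab111 k) := X.Syd ++ (X.d :: X.HD :: (X.S3 X.LD ++ X.leg₃.tail)).tail

/-- `SP2` is a self-avoiding path `E₁ → E₂`. [folklore] -/
theorem gSP2 : GPath (film k) X.SP2 E₁ E₂ := by
  have gT : GPath (film k) ((X.c :: X.HA :: X.S2 X.LA) ++ X.leg₂.tail) X.c E₂ :=
    X.gT2.trans X.hl2 fun v hv2 hvT => by
      rcases List.mem_cons.1 hvT with h | h
      · exact absurd (h ▸ X.cdy_S1.1) (X.l2_S1 v hv2)
      rcases List.mem_cons.1 h with h | h
      · exact absurd h (X.l2_hub X.isHub_A v hv2)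
      · exact X.l2_S2 X.isHub_A v hv2 h
  have gH : GPath (film k) (X.leg₁ ++ X.S1c.tail) E₁ X.c := X.hl1.trans X.gS1c fun v hvS hv1 => X.l1_S1 v hv1 (X.S1c_sub v hvS)
  exact gH.trans gT fun v hvT hvH => by
    rcases List.mem_append.1 hvT with hvT | hvT
    · rcases List.mem_cons.1 hvT with h | h
      · exact h
      rcases List.mem_cons.1 h with h | h
      · rcases List.mem_append.1 hvH with h' | h'
        · exact absurd h (X.l1_hub X.isHub_A _ h')
        · exact absurd (X.S1c_sub _ (List.mem_of_mem_tail h')) (h ▸ X.hub_S1 X.isHub_A)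
      · rcases List.mem_append.1 hvH with h' | h'
        · exact absurd h (X.l1_S2 X.isHub_A v h')
        · exact absurd h (X.S1_S2 X.isHub_A v (X.S1c_sub _ (List.mem_of_mem_tail h')))
    · have hv2 : v ∈ X.leg₂ := List.mem_of_mem_tail hvT
      rcases List.mem_append.1 hvH with h' | h'
      · exact absurd hv2 (X.l12 v h')
      · exact absurd (X.S1c_sub _ (List.mem_of_mem_tail h')) (X.l2_S1 v hv2)

/-- `SP2` decomposed. [folklore] -/
theorem SP2_eq : X.SP2 = X.leg₁.dropLast ++ X.S1c ++ (X.HA :: X.S2 X.LA ++ X.leg₂.tail) := by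
  rw [SP2, X.hl1.eq_dropLast_concat]
  have hs : X.S1c = X.e₁ :: X.S1c.tail := X.gS1c.eq_cons
  conv_rhs => rw [hs]
  simp [HubDataX.e₁]

/-- Membership in `SP2`. [folklore] -/
theorem mem_SP2 {v : slab111 k} (hv : v ∈ X.SP2) : v ∈ X.leg₁ ∨ v ∈ X.S1c ∨ v = X.HA ∨ v ∈ X.S2 X.LA ∨ v ∈ X.leg₂ := by
  rw [SP2_eq] at hv
  rcases List.mem_append.1 hv with hv | hv
  · rcases List.mem_append.1 hv with h | h
    · exact Or.inl (List.mem_of_mem_dropLast h)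
    · exact Or.inr (Or.inl h)
  · rcases List.mem_cons.1 hv with h | h
    · exact Or.inr (Or.inr (Or.inl h))
    rcases List.mem_append.1 h with h | h
    · exact Or.inr (Or.inr (Or.inr (Or.inl h)))
    · exact Or.inr (Or.inr (Or.inr (Or.inr (List.mem_of_mem_tail h))))

/-- The interior of `SP2` lies in `PR`. [folklore] -/
theorem SP2_PR : ∀ x ∈ X.SP2.tail.dropLast, x ∈ PR := by
  intro x hx
  obtain ⟨hxm, hxE1, hxE2⟩ := X.gSP2.mem_interior hx
  rcases X.mem_SP2 hxm with h | h | h | h | h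
  · exact X.l1_PR x h hxE1
  · exact X.S1_PR x (X.S1c_sub x h)
  · exact h ▸ X.hHA
  · exact (X.S2_facts X.isHub_A).2.1 x h
  · exact X.l2_PR x h hxE2

/-- `c, H_A` are consecutive on `SP2`. [folklore] -/
theorem SP2_cHA : ∃ l₁ l₂ : List (slab111 k), X.SP2 = l₁ ++ X.c :: X.HA :: l₂ := by
  refine ⟨X.leg₁.dropLast ++ X.S1c.dropLast, X.S2 X.LA ++ X.leg₂.tail, ?_⟩
  rw [SP2_eq]
  conv_lhs => rw [X.gS1c.eq_dropLast_concat]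
  simp

/-- `Br2` is a self-avoiding path `y → w'`. [folklore] -/
theorem gBr2 : GPath (film k) X.Br2 X.y w' := by
  have gc : GPath (film k) (X.S3 X.LD ++ X.leg₃.tail) (rideV k z c0 X.F3 (X.LD + X.d₃)) w' :=
    (X.S3_facts X.isHub_D).1.trans X.hl3 fun v hv3 hvS => X.l3_S3 X.isHub_D v hv3 hvS
  have gb : GPath (film k) (X.HD :: (X.S3 X.LD ++ X.leg₃.tail)) X.HD w' := by
    refine gc.cons (X.adj_hub3 X.isHub_D) ?_
    intro h
    rcases List.mem_append.1 h with h | h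
    · exact (X.S3_facts X.isHub_D).2.2.2.1 X.isHub_D h
    · exact X.l3_hub X.isHub_D _ (List.mem_of_mem_tail h) rfl
  have ga : GPath (film k) (X.d :: X.HD :: (X.S3 X.LD ++ X.leg₃.tail)) X.d w' := by
    refine gb.cons X.adj_HD_d.symm ?_
    intro h
    rcases List.mem_cons.1 h with h | h
    · exact X.hub_S1 X.isHub_D (by change X.HD ∈ X.S1; rw [← h]; exact X.cdy_S1.2.1)
    rcases List.mem_append.1 h with h | h
    · exact X.S1_S3 X.isHub_D _ X.cdy_S1.2.1 h
    · exact X.l3_S1 _ (List.mem_of_mem_tail h) X.cdy_S1.2.1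
  exact X.gSyd.trans ga fun v hvB hvS => by
    rcases List.mem_cons.1 hvB with h | h
    · exact h
    rcases List.mem_cons.1 h with h | h
    · exact absurd (X.Syd_sub v hvS) (h ▸ X.hub_S1 X.isHub_D)
    rcases List.mem_append.1 h with h | h
    · exact absurd h (X.S1_S3 X.isHub_D v (X.Syd_sub v hvS))
    · exact absurd (X.Syd_sub v hvS) (X.l3_S1 v (List.mem_of_mem_tail h))

/-- Membership in `Br2`. [folklore] -/
theorem mem_Br2 {x : slab111 k} (hx : x ∈ X.Br2) : x ∈ X.Syd ∨ x = X.HD ∨ x ∈ X.S3 X.LD ∨ x ∈ X.leg₃ := by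
  rcases List.mem_append.1 hx with h | h
  · exact Or.inl h
  rcases List.mem_cons.1 h with h | h
  · exact Or.inr (Or.inl h)
  rcases List.mem_append.1 h with h | h
  · exact Or.inr (Or.inr (Or.inl h))
  · exact Or.inr (Or.inr (Or.inr (List.mem_of_mem_tail h)))

/-- `Br2 ⊆ W`. [folklore] -/
theorem Br2_W : ∀ x ∈ X.Br2, x ∈ W := by
  intro x hx
  rcases X.mem_Br2 hx with h | h | h | h
  · exact X.hPRW (X.S1_PR x (X.Syd_sub x h))
  · exact h ▸ X.hPRW X.hHD
  · exact (X.S3_facts X.isHub_D).2.1 x h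
  · exact X.l3_W x h

/-- `Br2` is off `SP2`. [folklore] -/
theorem Br2_off : ∀ x ∈ X.Br2, x ∉ X.SP2 := by
  intro x hx hxP
  have hx' := X.mem_Br2 hx
  rcases X.mem_SP2 hxP with hP | hP | hP | hP | hP
  · -- x ∈ leg₁
    rcases hx' with h | h | h | h
    · exact X.S1c_Syd _ ((X.l1_S1 x hP (X.Syd_sub x h)) ▸ X.e1_mem.2) h
    · exact X.l1_hub X.isHub_D x hP h
    · exact X.l1_S3 X.isHub_D x hP h
    · exact X.l13 x hP h
  · -- x ∈ S1c
    rcases hx' with h | h | h | h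
    · exact X.S1c_Syd x hP h
    · exact X.hub_S1 X.isHub_D (by change X.HD ∈ X.S1; rw [← h]; exact X.S1c_sub x hP)
    · exact X.S1_S3 X.isHub_D x (X.S1c_sub x hP) h
    · exact X.l3_S1 x h (X.S1c_sub x hP)
  · -- x = HA
    rcases hx' with h | h | h | h
    · exact X.hub_S1 X.isHub_A (by change X.HA ∈ X.S1; rw [← hP]; exact X.Syd_sub _ h)
    · exact X.HA_ne_HD (hP ▸ h)
    · exact (X.S3_facts X.isHub_D).2.2.2.1 X.isHub_A (by change X.HA ∈ X.S3 X.LD; rw [← hP]; exact h)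
    · exact X.l3_hub X.isHub_A x h hP
  · -- x ∈ S2 LA
    rcases hx' with h | h | h | h
    · exact X.S1_S2 X.isHub_A x (X.Syd_sub x h) hP
    · exact (X.S2_facts X.isHub_A).2.2.2.1 X.isHub_D (by change X.HD ∈ X.S2 X.LA; rw [← h]; exact hP)
    · exact X.S2_S3 X.isHub_A X.isHub_D x hP h
    · exact X.l3_S2 X.isHub_A x h hP
  · -- x ∈ leg₂
    rcases hx' with h | h | h | h
    · exact X.l2_S1 x hP (X.Syd_sub x h)
    · exact X.l2_hub X.isHub_D x hP h
    · exact X.l2_S3 X.isHub_D x hP h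
    · exact X.l23 x hP h

/-- **ROUTING 2** of the hub construction: attachment vertex `c`, successor `H_A`, branch head `y`.
[cite: DuminilCopinSidoraviciusTassion2016, §2.3 (proof of Fact 2: γ_u, γ_v, γ_w)] -/
def route₂ : VRouteData (film k) PR W E₁ E₂ w' :=
  VRouteData.ofPaths X.gSP2 X.hne X.SP2_PR X.SP2_cHA X.gBr2 X.Br2_W X.adj_c_y X.Br2_off

/-- The successor of routing 2 is `H_A`. [folklore] -/
@[simp] theorem route₂_y : X.route₂.y = X.HA := VRouteData.ofPaths_y _ _ _ _ _ _ _ _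

/-- The branch head of routing 2 is `y`. [folklore] -/
@[simp] theorem route₂_b : X.route₂.b = X.y := VRouteData.ofPaths_b _ _ _ _ _ _ _ _

/-- **THE HUB ROUTING LEMMA**: the data of a hub routing yield a SWAP PAIR of routings (`y₁ = b₂ = y`, `b₁ = y₂ = H_A`) — the form the node
«HexShadowVRouteData».`ShapedLinkage` asks for.  Uniform in all levels; no search.
[cite: DuminilCopinSidoraviciusTassion2016, §2.3 (proof of Fact 2: the three disjoint paths γ_u, γ_v, γ_w in B_R(z))] -/
theorem hub_gml (X : HubDataX k z c0 W PR E₁ E₂ w') : ∃ r₁ r₂ : VRouteData (film k) PR W E₁ E₂ w', r₁.y = r₂.b ∧ r₁.b = r₂.y :=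
  ⟨X.route₁, X.route₂, by rw [route₁_y, route₂_b], by rw [route₁_b, route₂_y]⟩

end HubDataX

end Slab111

end Summit.CriticalPhenomena.PercolationContinuityZ3.Theorems.Transplant

end
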